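import Summits.QuantumFields.YangMills.Theorems.BackwardLiouvilleRigidityFlatRatioTerminationSkeletonGauge
import Literature.MathematicalPhysics.QuantumFieldTheory.Balaban1983to89.T3YM3TorusStatement
import Literature.MathematicalPhysics.QuantumFieldTheory.Balaban1983to89.T3NestedUnitLaws
import Literature.MathematicalPhysics.QuantumFieldTheory.Balaban1983to89.T3UnitLawDensityEML
import Literature.MathematicalPhysics.QuantumFieldTheory.Balaban1983to89.BalabanUVClass
import Literature.MathematicalPhysics.QuantumFieldTheory.Balaban1983to89.T3UnitScaleTilt
import Literature.MathematicalPhysics.QuantumFieldTheory.Balaban1983to89.T3Thresholds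
import Literature.MathematicalPhysics.QuantumFieldTheory.Balaban1983to89.T3ThresholdSmallness
import Literature.MathematicalPhysics.QuantumFieldTheory.Balaban1983to89.T3MinimiserStabilityReduction

/-!
# Route `BackwardLiouvilleRigidity`, support `FlatRatioTermination` (stmt-QuantumFields-22542) — registered stub
# `stub_innerWindowGaugeSmall`: INNER WINDOW ⇒ SMALL GLOBAL GAUGE

Planner ym-r3-idea-1 g10's re-cut skeleton (`Cruxes/FluctuationComparisonRegPrIntL/Lines/flat_ratio_termination.lean`, sha 6f6fdb21):
`stub_innerWindowGaugeSmall` (THIS FILE, the hardest stub) → `stub_gaugeSmallChains` ✓ → `stub_thresholds` ✓ → `stub_windowTV` ✓ →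
`stub_pushToZero` ✓.  STATEMENT (verbatim): for `p₀ ≥ pW` (`pW = 1`), every family, `γ ∈ (0,1]`, `b₀ > 0`, from some height on, every
`SU(2)` configuration with all plaquette variables within `θin_j = θBal L γ (√b₀) (p₀/2) j` of `1` has a gauge in which EVERY bond variable is
within `√θ_j/16` of `1`, `θ_j = θBal L γ b₀ p₀ j`.

PROOF.  `θin_j² = g_j·θ_j` exactly (`g_j = √(γL^{-j})`, `p(g) = b₀(1 + log g⁻¹)^{p₀}`).  Take the mesh `m = L^r ≤ 1/(4√θin_j) < L·m`
(`Nat.log`), so `16m²θin_j ≤ 1`, `2m ∣ N_j = 2L^{m_F+j}`, `2m < N_j` (for `j` large: `1/(4√θin_j) < L^{m_F+j}` because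
`θin_j ≥ √(γb₀) L^{-j/2}`), and apply the VOLUME-UNIFORM SMALL GAUGE `…SkeletonGauge.dist1_skeletonGauge_le` (CW-skeleton construction:
coarse vertices, then edges / faces / cubes filled by cone extensions of the boundary data times the torus axial gauge of the cell —
quantitative `π₁(S³) = π₂(S³) = 0`, no error accumulation across cells): every bond within `gaugeConst/m < 4L·gaugeConst·√θin_j`, and
`4L·gaugeConst·√θin_j ≤ √θ_j/16 ⟺ 2¹⁶(4L·gaugeConst)⁴ ≤ p(g_j)`, true from some height on since `p(g_j) → ∞`.

HONEST SCOPE.  Closes the last registered stub of the SUPPORT item `FlatRatioTermination` (with the four landed stubs the skeleton's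
`flatRatioTermination_of_stubs` becomes sorry-free) and makes S4a `stub_innerWindowChains` of LINE «run-pair organ» landable by name; the
crux `ClassLimitTrajectories` / `BackwardStabilityAdm`, rung R3 (RECORD rung) and every summit statement stay open; nothing here bears on
the Yang–Mills mass gap.
-/

namespace Summit.QuantumFields.YangMills.Theorems.FlatRatioTermination

open Filter Topology
open Literature.MathematicalPhysics.QuantumFieldTheory.Balaban1983to89
open Literature.MathematicalPhysics.QuantumFieldTheory.Balaban1983to89.T3ContinuumYM3Torus
open Literature.MathematicalPhysics.QuantumFieldTheory.Balaban1983to89.T3UnitScaleTilt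
open Skeleton (gaugeConst skeletonGauge dist1_skeletonGauge_le)

/-- From `1 < a²` and `0 ≤ a` conclude `1 < a`. [folklore] -/
theorem one_lt_of_one_lt_sq {a : ℝ} (ha : 0 ≤ a) (h : 1 < a ^ 2) : 1 < a := by
  by_contra hc
  push Not at hc
  have : a ^ 2 ≤ 1 := by nlinarith
  linarith

/-- THE MESH: for `0 < δ ≤ 1/16` and `1/(4√δ) < L^E` there is `m = L^r`, `r < E`, with `1 ≤ m`, `16m²δ ≤ 1` and `1/m < 4L√δ`.
[folklore] -/
theorem exists_mesh {L : ℕ} (hL : 1 < L) {δ : ℝ} (hδ : 0 < δ) (hδ1 : δ ≤ 1 / 16) {E : ℕ}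
    (hE : 1 / (4 * Real.sqrt δ) < (L : ℝ) ^ E) :
    ∃ r : ℕ, r < E ∧ 16 * ((L ^ r : ℕ) : ℝ) ^ 2 * δ ≤ 1 ∧ 1 / ((L ^ r : ℕ) : ℝ) < 4 * L * Real.sqrt δ := by
  have hLR : (1 : ℝ) < L := by exact_mod_cast hL
  have hsδ : 0 < Real.sqrt δ := Real.sqrt_pos.mpr hδ
  have hsδ4 : Real.sqrt δ ≤ 1 / 4 := by
    rw [show (1 : ℝ) / 4 = Real.sqrt ((1 / 4) ^ 2) by rw [Real.sqrt_sq (by norm_num)]]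
    exact Real.sqrt_le_sqrt (by norm_num; linarith)
  set y : ℝ := 1 / (4 * Real.sqrt δ) with hydef
  have hy1 : 1 ≤ y := by rw [hydef, le_div_iff₀ (by positivity)]; linarith
  have hfloor : ⌊y⌋₊ ≠ 0 := by
    have : 1 ≤ ⌊y⌋₊ := Nat.one_le_floor_iff _ |>.mpr hy1
    omega
  set r : ℕ := Nat.log L ⌊y⌋₊ with hr
  have h1 : L ^ r ≤ ⌊y⌋₊ := Nat.pow_log_le_self L hfloor
  have h2 : ⌊y⌋₊ < L ^ (r + 1) := Nat.lt_pow_succ_log_self hL _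
  have h1R : ((L ^ r : ℕ) : ℝ) ≤ y := (by exact_mod_cast h1 : ((L ^ r : ℕ) : ℝ) ≤ ⌊y⌋₊).trans (Nat.floor_le (by linarith))
  have h2R : y < ((L ^ (r + 1) : ℕ) : ℝ) := by
    have := Nat.lt_floor_add_one y
    have h2' : ((⌊y⌋₊ : ℕ) : ℝ) + 1 ≤ ((L ^ (r + 1) : ℕ) : ℝ) := by exact_mod_cast h2
    linarith
  have hmpos : (0 : ℝ) < ((L ^ r : ℕ) : ℝ) := by positivity
  refine ⟨r, ?_, ?_, ?_⟩
  · -- `L^r ≤ y < L^E`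
    have : ((L ^ r : ℕ) : ℝ) < (L : ℝ) ^ E := h1R.trans_lt hE
    have : (L : ℝ) ^ r < (L : ℝ) ^ E := by push_cast at this; exact this
    exact (pow_lt_pow_iff_right₀ hLR).mp this
  · -- `4 L^r √δ ≤ 1`
    have h4 : 4 * ((L ^ r : ℕ) : ℝ) * Real.sqrt δ ≤ 1 := by
      have := mul_le_mul_of_nonneg_right h1R (by positivity : (0 : ℝ) ≤ 4 * Real.sqrt δ)
      rw [hydef, div_mul_cancel₀ _ (by positivity)] at this; linarith
    have hsq : Real.sqrt δ ^ 2 = δ := Real.sq_sqrt hδ.le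
    nlinarith [mul_nonneg (mul_nonneg (by norm_num : (0:ℝ) ≤ 4) hmpos.le) hsδ.le]
  · -- `1/L^r < 4L√δ`
    rw [div_lt_iff₀ hmpos]
    have : y < L * ((L ^ r : ℕ) : ℝ) := by rw [pow_succ, mul_comm] at h2R; push_cast at h2R ⊢; linarith
    have := mul_lt_mul_of_pos_right this (by positivity : (0 : ℝ) < 4 * Real.sqrt δ)
    rw [hydef, div_mul_cancel₀ _ (by positivity)] at this
    linarith

/-- **REGISTERED STUB `stub_innerWindowGaugeSmall`** of the skeleton for `FlatRatioTermination` (stmt-QuantumFields-22542), verbatim: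
inner window ⇒ small global gauge, from some height on (`pW = 1`). [folklore] -/
theorem stub_innerWindowGaugeSmall : open MeasureTheory Filter Topology Literature.MathematicalPhysics.QuantumFieldTheory.Balaban1983to89 T3ContinuumYM3Torus T3NestedUnitLaws T3UnitLawDensityEML T4Continuum BalabanUVClass T3UnitScaleTilt in ∃ pW : ℝ, ∀ (p₀ : ℝ), pW ≤ p₀ → ∀ (F : T3Family) (γ b₀ : ℝ), 0 < γ → γ ≤ 1 → 0 < b₀ → ∃ jW : ℕ, ∀ j : ℕ, jW ≤ j → ∀ U : GaugeField (F.P j) 0 ↥(Matrix.specialUnitaryGroup (Fin 2) ℂ), PlaqSmall (θBal F.L γ (Real.sqrt b₀) (p₀ / 2) j) U → (∃ u : GaugeTransf (F.P j) 0 ↥(Matrix.specialUnitaryGroup (Fin 2) ℂ), ∀ b : PBond (F.P j) 0, dist1 (GaugeField.gaugeAct u U b) < Real.sqrt (θBal F.L γ b₀ p₀ j) / 16) := by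
  refine ⟨1, ?_⟩
  intro p₀ hp₀ F γ b₀ hγ hγ1 hb₀
  have hL1 : 1 < F.L := F.hL.2
  have hL1' : 1 ≤ F.L := hL1.le
  have hLR : (1 : ℝ) < F.L := by exact_mod_cast hL1
  have hLpos : (0 : ℝ) < F.L := by linarith
  -- couplings, logarithms, thresholds
  set g : ℕ → ℝ := fun j => Real.sqrt (γ * ((F.L : ℝ)⁻¹) ^ j) with hgdef
  have hg : ∀ j, 0 < g j ∧ g j ≤ 1 := fun j =>
    ⟨(T3ThresholdSmallness.sqrt_coupling_pos_le hL1' hγ j).1, T3Thresholds.coupling_le_one hL1' hγ hγ1 j⟩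
  set x : ℕ → ℝ := fun j => 1 + Real.log (g j)⁻¹ with hxdef
  have hx1 : ∀ j, 1 ≤ x j := fun j => by
    have : 0 ≤ Real.log (g j)⁻¹ := Real.log_nonneg (one_le_inv_iff₀.mpr ⟨(hg j).1, (hg j).2⟩)
    simp only [hxdef]; linarith
  have hsb : 0 < Real.sqrt b₀ := Real.sqrt_pos.mpr hb₀
  have hθ : ∀ j, θBal F.L γ b₀ p₀ j = g j * (b₀ * x j ^ p₀) := fun j => rfl
  have hθin : ∀ j, θBal F.L γ (Real.sqrt b₀) (p₀ / 2) j = g j * (Real.sqrt b₀ * x j ^ (p₀ / 2)) := fun j => rfl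
  have hxsq : ∀ j, x j ^ p₀ = x j ^ (p₀ / 2) * x j ^ (p₀ / 2) := fun j => by
    rw [← Real.rpow_add (by linarith [hx1 j])]; ring_nf
  have hθpos : ∀ j, 0 < θBal F.L γ b₀ p₀ j := fun j => T3MinimiserStabilityReduction.θBal_pos hL1' hγ hγ1 hb₀ _ _
  have hθinpos : ∀ j, 0 < θBal F.L γ (Real.sqrt b₀) (p₀ / 2) j := fun j =>
    T3MinimiserStabilityReduction.θBal_pos hL1' hγ hγ1 hsb _ _
  -- the key identity `θin² = g θ`
  have hkey : ∀ j, θBal F.L γ (Real.sqrt b₀) (p₀ / 2) j ^ 2 = g j * θBal F.L γ b₀ p₀ j := fun j => by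
    rw [hθin, hθ, hxsq]
    have : Real.sqrt b₀ ^ 2 = b₀ := Real.sq_sqrt hb₀.le
    nlinarith [this]
  -- the constants
  set CF : ℝ := 4 * F.L * gaugeConst with hCF
  have hGC : 0 < gaugeConst := by
    unfold gaugeConst; have := Cone.Cell.coneK_pos Skeleton.lam3; positivity
  have hCFpos : 0 < CF := by positivity
  set A : ℝ := 256 ^ 2 * CF ^ 4 with hA
  -- eventualities
  have hg0 : Tendsto g atTop (𝓝 0) := by
    have hpow : Tendsto (fun i : ℕ => γ * ((F.L : ℝ)⁻¹) ^ i) atTop (𝓝 0) := by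
      have h := (tendsto_pow_atTop_nhds_zero_of_lt_one (inv_nonneg.mpr hLpos.le) (inv_lt_one_of_one_lt₀ hLR)).const_mul γ
      rw [mul_zero] at h; exact h
    have h := (Real.continuous_sqrt.tendsto 0).comp hpow
    rw [Real.sqrt_zero] at h
    exact h
  have hginv : Tendsto (fun j => (g j)⁻¹) atTop atTop :=
    tendsto_inv_nhdsGT_zero.comp (tendsto_nhdsWithin_iff.mpr ⟨hg0, Eventually.of_forall fun j => (hg j).1⟩)
  have hxT : Tendsto x atTop atTop := by
    simp only [hxdef]
    exact tendsto_atTop_add_const_left _ 1 (Real.tendsto_log_atTop.comp hginv)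
  have hpT : Tendsto (fun j => b₀ * x j ^ p₀) atTop atTop :=
    Tendsto.const_mul_atTop hb₀ ((tendsto_rpow_atTop (by linarith)).comp hxT)
  have E1 : ∀ᶠ j in atTop, θBal F.L γ (Real.sqrt b₀) (p₀ / 2) j ≤ 1 / 16 :=
    (T3ThresholdSmallness.tendsto_θBal_atTop hL1 hγ (Real.sqrt b₀) (p₀ / 2)).eventually (eventually_le_nhds (by norm_num))
  have hLj : Tendsto (fun j : ℕ => 256 * (γ * b₀) * (F.L : ℝ) ^ j) atTop atTop :=
    Tendsto.const_mul_atTop (by positivity) (tendsto_pow_atTop_atTop_of_one_lt hLR)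
  have E2 : ∀ᶠ j in atTop, 1 < 256 * (γ * b₀) * (F.L : ℝ) ^ j := hLj.eventually_gt_atTop _
  have E3 : ∀ᶠ j in atTop, A ≤ b₀ * x j ^ p₀ := hpT.eventually_ge_atTop _
  obtain ⟨jW, hjW⟩ := eventually_atTop.mp (E1.and (E2.and E3))
  refine ⟨jW, fun j hj U hU => ?_⟩
  obtain ⟨e1, e2, e3⟩ := hjW j hj
  set δ := θBal F.L γ (Real.sqrt b₀) (p₀ / 2) j with hδdef
  set θ := θBal F.L γ b₀ p₀ j with hθdef
  have hδ : 0 < δ := hθinpos j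
  have hθp : 0 < θ := hθpos j
  have hsδ : 0 < Real.sqrt δ := Real.sqrt_pos.mpr hδ
  -- `1/(4√δ) < L^{m_F + j}`: square, `16 δ L^{2(m+j)} > 1` from `δ² ≥ γ b₀ L^{-j}`
  have hE : 1 / (4 * Real.sqrt δ) < (F.L : ℝ) ^ (F.m + j) := by
    rw [div_lt_iff₀ (by positivity)]
    have hLE : (1 : ℝ) ≤ (F.L : ℝ) ^ (F.m + j) := one_le_pow₀ hLR.le
    -- `δ ≥ g √b₀` and `g² = γ L^{-j}`
    have hδlow : g j * Real.sqrt b₀ ≤ δ := by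
      rw [hδdef, hθin]
      have h2 : 1 ≤ x j ^ (p₀ / 2) := Real.one_le_rpow (hx1 j) (by linarith)
      nlinarith [(hg j).1, hsb, mul_pos (hg j).1 hsb]
    have hsqg : g j ^ 2 = γ * ((F.L : ℝ)⁻¹) ^ j := by rw [hgdef]; exact Real.sq_sqrt (by positivity)
    have hLj1 : ((F.L : ℝ)⁻¹) ^ j * (F.L : ℝ) ^ j = 1 := by rw [← mul_pow, inv_mul_cancel₀ hLpos.ne', one_pow]
    -- `(16 δ L^{2E})² ≥ 256 γ b₀ L^{-j} L^{4E} ≥ 256 γ b₀ L^j > 1`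
    have hpowE : (F.L : ℝ) ^ j ≤ ((F.L : ℝ) ^ (F.m + j)) ^ 2 * (((F.L : ℝ)⁻¹) ^ j * ((F.L : ℝ) ^ (F.m + j)) ^ 2) := by
      have h4 : ((F.L : ℝ) ^ (F.m + j)) ^ 2 * (((F.L : ℝ)⁻¹) ^ j * ((F.L : ℝ) ^ (F.m + j)) ^ 2)
          = (F.L : ℝ) ^ (4 * F.m + 3 * j) * (((F.L : ℝ)⁻¹) ^ j * (F.L : ℝ) ^ j) := by ring
      rw [h4, hLj1, mul_one]
      exact pow_le_pow_right₀ hLR.le (by omega)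
    have hbig : 1 < (16 * δ * ((F.L : ℝ) ^ (F.m + j)) ^ 2) ^ 2 := by
      have h5 : (g j * Real.sqrt b₀) ^ 2 = γ * b₀ * ((F.L : ℝ)⁻¹) ^ j := by
        rw [mul_pow, hsqg, Real.sq_sqrt hb₀.le]; ring
      have h6 : (g j * Real.sqrt b₀) ^ 2 ≤ δ ^ 2 := pow_le_pow_left₀ (by positivity) hδlow 2
      calc (1 : ℝ) < 256 * (γ * b₀) * (F.L : ℝ) ^ j := e2
        _ ≤ 256 * (γ * b₀) * (((F.L : ℝ) ^ (F.m + j)) ^ 2 * (((F.L : ℝ)⁻¹) ^ j * ((F.L : ℝ) ^ (F.m + j)) ^ 2)) := by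
            gcongr
        _ = 256 * ((g j * Real.sqrt b₀) ^ 2) * (((F.L : ℝ) ^ (F.m + j)) ^ 2) ^ 2 := by rw [h5]; ring
        _ ≤ 256 * δ ^ 2 * (((F.L : ℝ) ^ (F.m + j)) ^ 2) ^ 2 := by gcongr
        _ = (16 * δ * ((F.L : ℝ) ^ (F.m + j)) ^ 2) ^ 2 := by ring
    have h7 : 1 < 16 * δ * ((F.L : ℝ) ^ (F.m + j)) ^ 2 := one_lt_of_one_lt_sq (by positivity) hbig
    have h8 : (Real.sqrt δ * 4 * (F.L : ℝ) ^ (F.m + j)) ^ 2 = 16 * δ * ((F.L : ℝ) ^ (F.m + j)) ^ 2 := by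
      rw [mul_pow, mul_pow, Real.sq_sqrt hδ.le]; ring
    have h9 := one_lt_of_one_lt_sq (by positivity) (h8 ▸ h7)
    linarith
  obtain ⟨r, hrE, h16, hinv⟩ := exists_mesh hL1 hδ e1 hE
  set mm : ℕ := F.L ^ r with hmm
  have hmm1 : 1 ≤ mm := Nat.one_le_pow _ _ (by omega)
  have hmmR : (0 : ℝ) < mm := by exact_mod_cast hmm1
  have hNnat : (F.P j).sitesPerDir 0 = 2 * F.L ^ (F.m + j) := by simp [Params.sitesPerDir]
  have hNdvd : (2 * mm : ℤ) ∣ ((F.P j).sitesPerDir 0 : ℤ) := by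
    rw [hNnat, hmm]; push_cast
    exact mul_dvd_mul_left 2 (pow_dvd_pow _ hrE.le)
  have h2mN : 2 * mm < (F.P j).sitesPerDir 0 := by
    rw [hNnat, hmm]
    exact Nat.mul_lt_mul_of_pos_left (Nat.pow_lt_pow_right hL1 hrE) two_pos
  have h16' : 16 * (mm : ℝ) ^ 2 * δ ≤ 1 := by rw [hmm]; exact h16
  refine ⟨skeletonGauge F j U mm, fun b => lt_of_le_of_lt (dist1_skeletonGauge_le hmm1 hNdvd h2mN hδ.le hU h16' b) ?_⟩
  -- `gaugeConst / m < CF √δ ≤ √θ / 16`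
  have step1 : gaugeConst / (mm : ℝ) < CF * Real.sqrt δ := by
    rw [hCF, div_eq_mul_one_div]
    have : 1 / (mm : ℝ) < 4 * F.L * Real.sqrt δ := by rw [hmm]; exact hinv
    nlinarith
  have step2 : CF * Real.sqrt δ ≤ Real.sqrt θ / 16 := by
    -- `A g ≤ θ`, hence `(256 CF² δ)² = A δ² ... ≤ θ²`, hence `256 CF² δ ≤ θ`, hence the claim by taking square roots
    have hAg : A * g j ≤ θ := by
      rw [hθdef, hθ]
      have := mul_le_mul_of_nonneg_left e3 (hg j).1.le
      calc A * g j = g j * A := by ring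
        _ ≤ g j * (b₀ * x j ^ p₀) := this
    have hsq1 : (256 * CF ^ 2 * δ) ^ 2 ≤ θ ^ 2 := by
      calc (256 * CF ^ 2 * δ) ^ 2 = A * δ ^ 2 := by rw [hA]; ring
        _ = A * g j * θ := by rw [hkey j]; ring
        _ ≤ θ * θ := mul_le_mul_of_nonneg_right hAg hθp.le
        _ = θ ^ 2 := by ring
    have hsq2 : 256 * CF ^ 2 * δ ≤ θ := by
      nlinarith [sq_nonneg (256 * CF ^ 2 * δ + θ), mul_pos (by positivity : (0:ℝ) < 256 * CF ^ 2 * δ) hθp]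
    have h3 : CF * Real.sqrt δ = Real.sqrt (CF ^ 2 * δ) := by
      rw [Real.sqrt_mul (by positivity), Real.sqrt_sq hCFpos.le]
    have h4 : Real.sqrt θ / 16 = Real.sqrt (θ / 256) := by
      rw [Real.sqrt_div hθp.le, show (256 : ℝ) = 16 ^ 2 by norm_num, Real.sqrt_sq (by norm_num)]
    rw [h3, h4]
    exact Real.sqrt_le_sqrt (by linarith)
  exact step1.trans_le step2

end Summit.QuantumFields.YangMills.Theorems.FlatRatioTermination
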